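import Summits.HubbardSuperconductivity.HubbardLadder.Bounds.SectorTwistNumerator
import Summits.HubbardSuperconductivity.HubbardLadder.Bounds.FugacityCentringWindow
import HarnessLib

/-!
# The N-sector twist-insensitivity RATIO bound, conditional on the variance and walk inputs
# (bounds.tex Theorem 13, N-sector form: assembly of (13.1)–(13.3) with Lemmas 13.3–13.5)

HONEST FRAMING (cell pub-hubbard): ladder R1–R4 with certified numbers; no claim on H/H₀. Bounds for
model classes (the seam-twisted translation-invariant `t–t'` Hubbard torus, canonical
`N`-particle sector), no materials claim. Imports only parts F8a (`SectorTwistNumerator`, LEAN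
FILING REQUEST #211.6) and F8b (`FugacityCentringWindow`, #211.7) of this device.

This is part F8c of the kernel device for bounds.tex Theorem 13 in the N-sector form. It links the
abstract tilted sums of part F8b to the model — the canonical sector partition functions
`ttSectorZ L β t' U θ k = Tr_{#=k} e^{-β H^{tt'}_L(θ)}` are positive reals and
`Zc(β,U,s/β; c_θ) = Σ_k e^{sk} ttSectorZ … θ k` (so that
`|Zc(β,U,s/β; c_0)| = gcSum (ttSectorWeight …) |Orb Λ_L| s`) — and assembles the numerator bound
of part F8a with the Chebyshev window of part F8b and a walk along adjacent sectors into the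
RELATIVE twist-insensitivity bound

  `‖Z_N(θ) - Z_N(0)‖ ≤ (2K+1) e^{2 G K_w} / (1 - V/K²)`
  `    · ( (e^{ε_L} - 1) + 2 z(s)^{|Λ_L|} e^{(F-e^{κ}-κ)|Λ_L|} / Z^{gc}(0;s) ) · Z_N(0)`

(`norm_ttSectorZ_twist_sub_le`), CONDITIONAL on two analytic inputs that are NOT proved in this file
and enter as hypotheses with fixed signatures (they are the successor parts of the device):
* (VARIANCE, bounds.tex Lemma 13.4) `gcVar (ttSectorWeight L β t' U) |Orb Λ_L| s ≤ V` with
  `V < K²` — to be discharged with `V = v L²`, `K = λ √v L` by the Cauchy estimate for the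
  ζ-analytic Kotecký–Preiss logarithm (part F8b's `hasDerivAt_gcMean` is the entry point);
* (WALK, bounds.tex Lemma 13.5 second half) adjacent tilted sector weights in the window
  `|k - N| ≤ K_w` are comparable up to a factor `e^{G}` — to be discharged by the commutator /
  locality bound `‖e^{βH} c_{xσ} e^{-βH} - c_{xσ}‖ ≤ r` and
  `(k+1) Z_{k+1} = (2|Λ| - k) Z_k + O(r|Λ| Z_k)`;
together with a centring slack `|gcMean - N| ≤ K₀` (`K₀ = 0` is part F8b's `exists_gcMean_eq`).

Also: the abstract walk lemma `le_pow_mul_of_adjacent_le` (comparability of adjacent terms on an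
integer window propagates with the factor `c^{hi-lo}`).

References: bounds.tex §13; D. Ueltschi, J. Stat. Phys. 95 (1999) 693, §2.3 [Ueltschi1999];
R. Kotecký, D. Preiss, Comm. Math. Phys. 103 (1986) 491 [KoteckyPreiss1986]; D. Ruelle, Statistical
Mechanics (1969) §3.4 [Ruelle1969].
-/

noncomputable section

namespace Summit.HubbardSuperconductivity.HubbardLadder.Bounds

open Matrix Finset Complex
open Literature.MathematicalPhysics.QuantumLattice
open Summit.HubbardSuperconductivity.HubbardSuperconductivity.Theorems.WidthHaldane
open scoped ComplexOrder

/-! ### An abstract walk lemma -/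

/-- **Walk lemma.** If `f ≥ 0` and adjacent values on the integer window `[lo, hi]` are comparable
up to a factor `c ≥ 1` (`f (k+1) ≤ c f k` and `f k ≤ c f (k+1)`), then any two values in the window
are comparable up to `c^{hi-lo}`. [folklore] -/
theorem le_pow_mul_of_adjacent_le {f : ℕ → ℝ} {c : ℝ} (hc : 1 ≤ c) (hf : ∀ k, 0 ≤ f k) {lo hi : ℕ}
    (hadj : ∀ k, lo ≤ k → k + 1 ≤ hi → f (k + 1) ≤ c * f k ∧ f k ≤ c * f (k + 1))
    {p q : ℕ} (hp : lo ≤ p) (hp' : p ≤ hi) (hq : lo ≤ q) (hq' : q ≤ hi) :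
    f p ≤ c ^ (hi - lo) * f q := by
  have hc0 : 0 ≤ c := by linarith
  have step : ∀ d p, lo ≤ p → p + d ≤ hi →
      f (p + d) ≤ c ^ d * f p ∧ f p ≤ c ^ d * f (p + d) := by
    intro d
    induction d with
    | zero => intro p _ _; simp
    | succ d ih =>
      intro p hp hpd
      rw [← Nat.add_assoc] at hpd ⊢
      obtain ⟨h1, h2⟩ := ih p hp (by omega)
      obtain ⟨h3, h4⟩ := hadj (p + d) (by omega) hpd
      have hcd : 0 ≤ c ^ d := pow_nonneg hc0 d
      refine ⟨?_, ?_⟩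
      · calc f (p + d + 1) ≤ c * f (p + d) := h3
          _ ≤ c * (c ^ d * f p) := mul_le_mul_of_nonneg_left h1 hc0
          _ = c ^ (d + 1) * f p := by ring
      · calc f p ≤ c ^ d * f (p + d) := h2
          _ ≤ c ^ d * (c * f (p + d + 1)) := mul_le_mul_of_nonneg_left h4 hcd
          _ = c ^ (d + 1) * f (p + d + 1) := by ring
  rcases le_total p q with hpq | hqp
  · obtain ⟨d, rfl⟩ := Nat.exists_eq_add_of_le hpq
    calc f p ≤ c ^ d * f (p + d) := (step d p hp hq').2
      _ ≤ c ^ (hi - lo) * f (p + d) :=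
          mul_le_mul_of_nonneg_right (pow_le_pow_right₀ hc (by omega)) (hf _)
  · obtain ⟨d, rfl⟩ := Nat.exists_eq_add_of_le hqp
    calc f (q + d) ≤ c ^ d * f q := (step d q hq hp').1
      _ ≤ c ^ (hi - lo) * f q :=
          mul_le_mul_of_nonneg_right (pow_le_pow_right₀ hc (by omega)) (hf _)

/-! ### The canonical sector partition functions of the twisted torus -/

section Torus

variable {L : ℕ} [NeZero L]

/-- The canonical `k`-particle partition function of the seam-twisted `t–t'` Hubbard torus,
`Z_k(θ) = Tr( e^{-βH^{tt'}_L(θ)} |_{#s = k} ) = partitionFn β (H^{tt'}_L(θ)|_{#s=k})`.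
[programme definition: bounds.tex §13, Theorem 13 (N-sector form)] -/
def ttSectorZ (L : ℕ) [NeZero L] (β t' U θ : ℝ) (k : ℕ) : ℂ :=
  partitionFn β ((hubbardTorusTT'Flux L t' U θ).toBlock (fun x => x.card = k) (fun x => x.card = k))

/-- The untwisted sector weights `w_k = Re Z_k(0)` (`= Z_k(0)`, a positive real), the weights fed to
part F8b. [programme definition: bounds.tex §13, Lemma 13.3] -/
def ttSectorWeight (L : ℕ) [NeZero L] (β t' U : ℝ) (k : ℕ) : ℝ := (ttSectorZ L β t' U 0 k).re

/-- `Z_k(θ)` is the diagonal sum of the Gibbs weight over the `k`-particle basis states (part F1).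
[this file] -/
theorem ttSectorZ_eq_sum (β t' U θ : ℝ) (k : ℕ) :
    ttSectorZ L β t' U θ k =
      ∑ x ∈ Finset.univ.filter (fun x : Finset (Orb (FermionTorus 2 L)) => x.card = k),
        gibbsWeight β (hubbardTorusTT'Flux L t' U θ) x x :=
  partitionFn_toBlock_card_eq_sum_gibbsWeight
    (card_eq_of_preservesSectors (preservesSectors_hubbardTorusTT'Flux L t' U θ)) β k

/-- **Positivity of the sector partition functions**: for `k ≤ |Orb Λ_L|`, `Z_k(θ)` is a positive
real (the Gibbs weight of the Hermitian `H_θ` is positive definite and the `k`-particle sector is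
nonempty). [folklore; this file] -/
theorem ttSectorZ_pos (β t' U θ : ℝ) {k : ℕ} (hk : k ≤ Fintype.card (Orb (FermionTorus 2 L))) :
    0 < (ttSectorZ L β t' U θ k).re ∧ (ttSectorZ L β t' U θ k).im = 0 := by
  have hpd : (gibbsWeight β (hubbardTorusTT'Flux L t' U θ)).PosDef :=
    Matrix.posDef_gibbsWeight β (isHermitian_hubbardTorusTT'Flux L t' U θ)
  have hne :
      (Finset.univ.filter (fun x : Finset (Orb (FermionTorus 2 L)) => x.card = k)).Nonempty := by
    obtain ⟨x, -, hx⟩ := Finset.exists_subset_card_eq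
      (s := (Finset.univ : Finset (Orb (FermionTorus 2 L)))) (n := k) (by rwa [Finset.card_univ])
    exact ⟨x, Finset.mem_filter.2 ⟨Finset.mem_univ _, hx⟩⟩
  have hpos : 0 < ttSectorZ L β t' U θ k := by
    rw [ttSectorZ_eq_sum]
    exact Finset.sum_pos (fun x _ => hpd.diag_pos) hne
  obtain ⟨hre, him⟩ := Complex.pos_iff.1 hpos
  exact ⟨hre, him.symm⟩

/-- `Z_k(θ)` equals the real number `Re Z_k(θ)` (`k ≤ |Orb Λ_L|`). [this file] -/
theorem ttSectorZ_eq_ofReal_re (β t' U θ : ℝ) {k : ℕ}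
    (hk : k ≤ Fintype.card (Orb (FermionTorus 2 L))) :
    ttSectorZ L β t' U θ k = (((ttSectorZ L β t' U θ k).re : ℝ) : ℂ) :=
  Complex.ext (by simp) (by simp [(ttSectorZ_pos β t' U θ hk).2])

/-- The untwisted sector weights are positive: `0 < w_k` for `k ≤ |Orb Λ_L|`. [this file] -/
theorem ttSectorWeight_pos (β t' U : ℝ) {k : ℕ} (hk : k ≤ Fintype.card (Orb (FermionTorus 2 L))) :
    0 < ttSectorWeight L β t' U k :=
  (ttSectorZ_pos β t' U 0 hk).1

/-- **Model link (fugacity decomposition).** For `L ≥ 3`, `β ≠ 0` and a real fugacity `s`: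
`Zc(β,U,s/β; c_θ) = Σ_{k ≤ |Orb Λ_L|} e^{sk} Z_k(θ)` (part F1's dictionary, grouped by particle
number). [this file] -/
theorem Zc_ofReal_div_eq_sum_ttSectorZ (hL : 3 ≤ L) {β : ℝ} (hβ : β ≠ 0) (t' U θ s : ℝ) :
    Zc (β : ℂ) (U : ℂ) ((s : ℂ) / β) (ttFluxCoupling L β t' θ) =
      ∑ k ∈ Finset.range (Fintype.card (Orb (FermionTorus 2 L)) + 1),
        cexp (s * k) * ttSectorZ L β t' U θ k := by
  rw [← trace_fugacity_mul_gibbsWeight_hubbardTorusTT'Flux_eq_Zc hL hβ t' U θ (s : ℂ)]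
  set G := gibbsWeight β (hubbardTorusTT'Flux L t' U θ) with hG
  have htr :
      ((diagonal fun x : Finset (Orb (FermionTorus 2 L)) => cexp ((s : ℂ) * x.card)) * G).trace =
        ∑ x, cexp ((s : ℂ) * x.card) * G x x := by
    simp [Matrix.trace, Matrix.diagonal_mul]
  rw [htr]
  have hfib := Finset.sum_fiberwise_of_maps_to
    (s := (Finset.univ : Finset (Finset (Orb (FermionTorus 2 L)))))
    (t := Finset.range (Fintype.card (Orb (FermionTorus 2 L)) + 1)) (g := fun x => x.card)
    (fun x _ => Finset.mem_range.2 (Nat.lt_succ_of_le (Finset.card_le_univ x)))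
    (fun x => cexp ((s : ℂ) * x.card) * G x x)
  rw [← hfib]
  refine Finset.sum_congr rfl fun k _ => ?_
  rw [ttSectorZ_eq_sum, Finset.mul_sum]
  refine Finset.sum_congr rfl fun x hx => ?_
  rw [(Finset.mem_filter.1 hx).2]

/-- **Model link, real form.** `|Zc(β,U,s/β; c_0)| = gcSum (ttSectorWeight L β t' U) |Orb Λ_L| s`:
the untwisted generalised Gibbs factor at real fugacity is the tilted sum of the positive sector
weights. [this file] -/
theorem norm_Zc_ofReal_div_eq_gcSum (hL : 3 ≤ L) {β : ℝ} (hβ : β ≠ 0) (t' U s : ℝ) :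
    ‖Zc (β : ℂ) (U : ℂ) ((s : ℂ) / β) (ttFluxCoupling L β t' 0)‖ =
      gcSum (ttSectorWeight L β t' U) (Fintype.card (Orb (FermionTorus 2 L))) s := by
  have hsum : Zc (β : ℂ) (U : ℂ) ((s : ℂ) / β) (ttFluxCoupling L β t' 0) =
      ((gcSum (ttSectorWeight L β t' U) (Fintype.card (Orb (FermionTorus 2 L))) s : ℝ) : ℂ) := by
    rw [Zc_ofReal_div_eq_sum_ttSectorZ hL hβ t' U 0 s, gcSum, Complex.ofReal_sum]
    refine Finset.sum_congr rfl fun k hk => ?_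
    rw [ttSectorZ_eq_ofReal_re β t' U 0 (Nat.lt_succ_iff.1 (Finset.mem_range.1 hk)), ttSectorWeight,
      Complex.ofReal_mul, Complex.ofReal_exp, Complex.ofReal_mul, Complex.ofReal_natCast]
  rw [hsum, Complex.norm_real, Real.norm_eq_abs,
    abs_of_pos (gcSum_pos (fun k hk => ttSectorWeight_pos β t' U hk) s)]

/-! ### The conditional ratio bound -/

/-- **THEOREM (N-sector twist insensitivity, conditional form; bounds.tex Theorem 13 N-sector
form, assembly).** Under the hypotheses of part F8a's numerator bound at the real base fugacity `s`
and with `N ≤ |Orb Λ_L|`; GIVEN (variance) `gcVar w n s ≤ V < K²`, `K ≥ 1`, (centring slack)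
`|gcMean w n s - N| ≤ K₀`, an integer walk radius `K_w ≥ K + K₀`, and (walk) the comparability
`e^{s(k+1)} w_{k+1} ≤ e^{G} e^{sk} w_k`, `e^{sk} w_k ≤ e^{G} e^{s(k+1)} w_{k+1}` for all `k` with
`N - K_w ≤ k < k+1 ≤ min(N + K_w, n)` (`w = ttSectorWeight L β t' U`, `n = |Orb Λ_L|`, `G ≥ 0`):
`‖Z_N(θ) - Z_N(0)‖ ≤ (2K+1) (e^{G})^{2K_w} / (1 - V/K²)`
`    · ((e^{ε_L} - 1) + 2 z(βU,s)^{|Λ_L|} e^{(F-e^{κ}-κ)|Λ_L|} / gcSum w n s) · Re Z_N(0)`.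
[programme: bounds.tex §13, Theorem 13 N-sector form; this file] -/
theorem norm_ttSectorZ_twist_sub_le (hL : 3 ≤ L) {β : ℝ} (hβ : β ≠ 0) (t' U θ : ℝ)
    {M N : ℕ} (hM : Fintype.card (Orb (FermionTorus 2 L)) < M) (hN : N < M)
    (hNn : N ≤ Fintype.card (Orb (FermionTorus 2 L))) (s : ℝ)
    (hz : ∀ k ∈ Finset.range M,
      atomicPartitionFn (β : ℂ) (U : ℂ) (fourierPoint M (s : ℂ) k / β) ≠ 0)
    {c₀ u₀ R a δ F : ℝ} (hc₀ : 0 ≤ c₀) (hc1 : c₀ ≤ 1) (hv : |β * U| ≤ u₀) (hR : 0 < R)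
    (hfloor : 1 ≤ R ^ 2 * (1 - (1 - c₀) / 2 - (1 - c₀ ^ 2) / (1 + Real.exp (-(u₀ / 2))) ^ 2))
    (ha : 0 < a) (hδ : 0 < δ)
    (hsmall : 16 * (|β| * (1 + |t'|)) * Real.exp (2 * (|β| * (1 + |t'|))) *
      (R * Real.exp (a + δ) + a) ^ 2 ≤ a)
    (hF : Real.exp (offArcRate c₀ u₀ (β * U) s) +
      16 * (|β| * (1 + |t'|)) * Real.exp (2 * (|β| * (1 + |t'|))) * F ^ 2 ≤ F)
    {K V K₀ G : ℝ} {Kw : ℕ} (hK : 1 ≤ K)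
    (hV : gcVar (ttSectorWeight L β t' U) (Fintype.card (Orb (FermionTorus 2 L))) s ≤ V)
    (hVK : V < K ^ 2)
    (hm : |gcMean (ttSectorWeight L β t' U) (Fintype.card (Orb (FermionTorus 2 L))) s - N| ≤ K₀)
    (hKw : K + K₀ ≤ Kw) (hG : 0 ≤ G)
    (hadj : ∀ k : ℕ, N - Kw ≤ k → k + 1 ≤ min (N + Kw) (Fintype.card (Orb (FermionTorus 2 L))) →
      Real.exp (s * (k + 1 : ℕ)) * ttSectorWeight L β t' U (k + 1) ≤
          Real.exp G * (Real.exp (s * k) * ttSectorWeight L β t' U k) ∧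
        Real.exp (s * k) * ttSectorWeight L β t' U k ≤
          Real.exp G * (Real.exp (s * (k + 1 : ℕ)) * ttSectorWeight L β t' U (k + 1))) :
    ‖ttSectorZ L β t' U θ N - ttSectorZ L β t' U 0 N‖ ≤
      (2 * K + 1) * Real.exp G ^ (2 * Kw) / (1 - V / K ^ 2) *
        ((Real.exp (2 * a * (L : ℝ) ^ 2 * Real.exp (-(δ * L))) - 1) +
          2 * (atomicZ (β * U) s ^ Fintype.card (FermionTorus 2 L) *
            Real.exp ((F - Real.exp (offArcRate c₀ u₀ (β * U) s) - offArcRate c₀ u₀ (β * U) s) *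
              Fintype.card (FermionTorus 2 L))) /
            gcSum (ttSectorWeight L β t' U) (Fintype.card (Orb (FermionTorus 2 L))) s) *
        (ttSectorZ L β t' U 0 N).re := by
  set n := Fintype.card (Orb (FermionTorus 2 L)) with hn
  set w := ttSectorWeight L β t' U with hw_def
  have hw : ∀ k ≤ n, 0 < w k := fun k hk => ttSectorWeight_pos β t' U hk
  set Z := gcSum w n s with hZ_def
  have hZ : 0 < Z := gcSum_pos hw s
  set E := Real.exp (2 * a * (L : ℝ) ^ 2 * Real.exp (-(δ * L))) - 1 with hE_def
  set T := atomicZ (β * U) s ^ Fintype.card (FermionTorus 2 L) *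
    Real.exp ((F - Real.exp (offArcRate c₀ u₀ (β * U) s) - offArcRate c₀ u₀ (β * U) s) *
      Fintype.card (FermionTorus 2 L)) with hT_def
  have hE : 0 ≤ E := sub_nonneg.2 (Real.one_le_exp (by positivity))
  have hT : 0 ≤ T := by have := atomicZ_pos (β * U) s; positivity
  have hB : 0 ≤ E + 2 * T / Z := add_nonneg hE (div_nonneg (by positivity) hZ.le)
  -- the numerator (part F8a), with `|Zc(0;s)| = Z`
  have hnum : ‖ttSectorZ L β t' U θ N - ttSectorZ L β t' U 0 N‖ ≤
      Real.exp (-(s * N)) * (Z * E + 2 * T) := by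
    have h := norm_partitionFn_toBlock_card_twist_sub_le hL hβ t' U θ hM hN s hz hc₀ hc1 hv hR
      hfloor ha hδ hsmall hF
    rw [norm_Zc_ofReal_div_eq_gcSum hL hβ t' U s] at h
    exact h
  -- the Chebyshev window (part F8b)
  obtain ⟨Ns, hNs_le, hNs_win, hNs⟩ := exists_window_term_ge hw s hK
  have hK2 : 0 < K ^ 2 := by positivity
  have hfrac : 0 < 1 - V / K ^ 2 := by
    rw [sub_pos, div_lt_one hK2]; exact hVK
  have hZle : Z ≤ (2 * K + 1) / (1 - V / K ^ 2) * (Real.exp (s * Ns) * w Ns) := by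
    have h1 : (1 - V / K ^ 2) * Z ≤ (1 - gcVar w n s / K ^ 2) * Z :=
      mul_le_mul_of_nonneg_right (by gcongr) hZ.le
    rw [div_mul_eq_mul_div, le_div_iff₀ hfrac]
    linarith
  -- the walk from `Ns` to `N`
  have hc : (1 : ℝ) ≤ Real.exp G := Real.one_le_exp hG
  have hf0 : ∀ k : ℕ, 0 ≤ Real.exp (s * k) * w k := by
    intro k
    by_cases hk : k ≤ n
    · exact mul_nonneg (Real.exp_nonneg _) (hw k hk).le
    · -- outside the range the weight is still a nonnegative real part of a partition function
      have : 0 ≤ w k := by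
        show 0 ≤ (ttSectorZ L β t' U 0 k).re
        rw [ttSectorZ_eq_sum, Complex.re_sum]
        exact Finset.sum_nonneg fun x _ => (Complex.nonneg_iff.1
          ((Matrix.posDef_gibbsWeight β
            (isHermitian_hubbardTorusTT'Flux L t' U 0)).posSemidef.diag_nonneg)).1
      exact mul_nonneg (Real.exp_nonneg _) this
  have hNs_lo : N - Kw ≤ Ns ∧ Ns ≤ min (N + Kw) n := by
    have h1 : |(Ns : ℝ) - N| ≤ Kw := by
      have := abs_sub_le (Ns : ℝ) (gcMean w n s) N
      linarith
    rw [abs_le] at h1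
    obtain ⟨h1a, h1b⟩ := h1
    have h2 : (Ns : ℝ) ≤ N + Kw := by linarith
    have h3 : (N : ℝ) ≤ Ns + Kw := by linarith
    have h2' : Ns ≤ N + Kw := by exact_mod_cast h2
    have h3' : N ≤ Ns + Kw := by exact_mod_cast h3
    exact ⟨by omega, le_min h2' hNs_le⟩
  have hwalk : Real.exp (s * Ns) * w Ns ≤ Real.exp G ^ (2 * Kw) * (Real.exp (s * N) * w N) := by
    have h := le_pow_mul_of_adjacent_le (f := fun k => Real.exp (s * k) * w k) hc hf0
      (lo := N - Kw) (hi := min (N + Kw) n)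
      (fun k hk hk1 => by
        have h := hadj k hk hk1
        simpa only [Nat.cast_succ] using h)
      hNs_lo.1 hNs_lo.2 (Nat.sub_le N Kw) (le_min (Nat.le_add_right N Kw) hNn)
    refine h.trans (mul_le_mul_of_nonneg_right (pow_le_pow_right₀ hc ?_) (hf0 N))
    omega
  -- assembly
  have hpow : 0 ≤ Real.exp G ^ (2 * Kw) := pow_nonneg (Real.exp_nonneg _) _
  have halg : Z * E + 2 * T = Z * (E + 2 * T / Z) := by field_simp
  have hsN : Real.exp (-(s * N)) * Real.exp (s * N) = 1 := by rw [← Real.exp_add]; simp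
  calc ‖ttSectorZ L β t' U θ N - ttSectorZ L β t' U 0 N‖
      ≤ Real.exp (-(s * N)) * (Z * (E + 2 * T / Z)) := by rw [← halg]; exact hnum
    _ ≤ Real.exp (-(s * N)) *
        ((2 * K + 1) / (1 - V / K ^ 2) * (Real.exp G ^ (2 * Kw) * (Real.exp (s * N) * w N)) *
          (E + 2 * T / Z)) := by
        refine mul_le_mul_of_nonneg_left (mul_le_mul_of_nonneg_right (hZle.trans ?_) hB)
          (Real.exp_nonneg _)
        exact mul_le_mul_of_nonneg_left hwalk (div_nonneg (by linarith) hfrac.le)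
    _ = (2 * K + 1) * Real.exp G ^ (2 * Kw) / (1 - V / K ^ 2) * (E + 2 * T / Z) *
          (Real.exp (-(s * N)) * Real.exp (s * N)) * w N := by ring
    _ = (2 * K + 1) * Real.exp G ^ (2 * Kw) / (1 - V / K ^ 2) * (E + 2 * T / Z) *
          (ttSectorZ L β t' U 0 N).re := by rw [hsN, mul_one, hw_def]; rfl

end Torus

end Summit.HubbardSuperconductivity.HubbardLadder.Bounds

end
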